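import Summits.ValiantsHypothesis.ValiantsHypothesis.Theorems.LacunarySymmetroidMatrixDescartesChainLadder
import Summits.ValiantsHypothesis.ValiantsHypothesis.Theorems.LacunarySymmetroidMatrixDescartesCensusM2K6G18

/-!
# `MatrixDescartes` census — the CHAIN-LADDER RAYS of the certified row `M2K6G18`: `ζ_sym(2, 5(j+1)+1+i) ≥ 18(j+1) + 2·i`

HONEST FRAMING.  Object-search cell `pub-symmetroid`, crux `Theses.LacunarySymmetroid.MatrixDescartes`
(stmt-ValiantsHypothesis-18050); seat val-sym-mdr-p1 (g8).  LOWER-bound rows in census (CONJECTURE-A) currency; nothing about the crux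
`MatrixDescartes` (upper bound at fat formats), `DoorA26` / `DoorA34`, or `VP ≠ VNP`.  No definitions.

The typer's kernel certificate `Census.M2K6G18` (`ζ_sym(2,6) ≥ 18`: closed form `Census.M2K6G18.eval_det` + sign alternation at 19 rational
points) is fed — with the SAME certificate data and tactic blocks, re-checked here once — to the CHAIN LADDER in certificate form
(`Chain.not_posRootLawAt_ladder_add_of_certificate`: chaining the certificate with its own `x ↦ 1/x` reversal `j` times multiplies the
alternation count by `j+1` at the price of `5` letters per copy, and each of `i` grafted letters buys `m = 2` more), giving the
two-parameter family `ray (j i) : ¬ PosRootLawAt 2 ((j+1)·5 + 1 + i) ((j+1)·18 + i·2 − 1)` and numeral instances.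
[folklore] (intermediate value theorem; certificate arithmetic by `norm_num`, heartbeat budget as in the source certificate file).
-/

-- `Summit.ValiantsHypothesis.ValiantsHypothesis.…` repeats a component by the D-0017 layout
-- (single-conjunct summit), which the `dupNamespace` linter flags; the name is mandated.
set_option linter.dupNamespace false

namespace Summit.ValiantsHypothesis.ValiantsHypothesis.Theorems.LacunarySymmetroidMatrixDescartes.Census.Chain.RayM2K6G18

open Summit.ValiantsHypothesis.ValiantsHypothesis.Theorems.MatrixDescartes.Negative (PosRootLawAt)
open scoped BigOperators Matrix

-- 19 + 18 exact evaluations of the certificate's closed form exceed the default heartbeat budget (as in `Census.M2K6G18`).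
set_option maxHeartbeats 20000000 in
set_option exponentiation.threshold 467 in
/-- **The chain-ladder rays of `M2K6G18`**: for every `j, i`, `ζ_sym(2, 5(j+1)+1+i) ≥ 18(j+1) + 2i` —
`¬ PosRootLawAt 2 ((j+1)·5 + 1 + i) ((j+1)·18 + i·2 − 1)` (the certified `18`-alternation row laddered `j` times and grafted `i` times).
[folklore] -/
theorem ray (j i : ℕ) : ¬ PosRootLawAt 2 ((j + 1) * 5 + 1 + i) ((j + 1) * 18 + i * 2 - 1) :=
  Summit.ValiantsHypothesis.ValiantsHypothesis.Theorems.LacunarySymmetroidMatrixDescartes.Census.Chain.not_posRootLawAt_ladder_add_of_certificate (N := 18)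
    (fun t => (Summit.ValiantsHypothesis.ValiantsHypothesis.Theorems.LacunarySymmetroidMatrixDescartes.Census.eval_det_pencil_eq _ _ t).symm.trans (Summit.ValiantsHypothesis.ValiantsHypothesis.Theorems.LacunarySymmetroidMatrixDescartes.Census.M2K6G18.eval_det t))
    (by intro l; fin_cases l <;> (unfold Matrix.IsSymm; ext i j; fin_cases i <;> fin_cases j <;> rfl))
    (![1/8, 7/32, 1/4, 3/8, 13/32, 1/2, 3/4, 2, 9/4, 3, 4, 5, 21/4, 11/2, 6, 8, 12, 32, 64] : Fin 19 → ℝ)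
    (by
      refine Fin.strictMono_iff_lt_succ.2 fun j => ?_
      fin_cases j <;> simp only [Fin.castSucc_mk, Fin.succ_mk] <;> norm_num)
    (by intro j; fin_cases j <;> norm_num)
    (by intro j; fin_cases j <;> simp only [Fin.castSucc_mk, Fin.succ_mk] <;> norm_num)
    (by norm_num) j i

/-- `ζ_sym(2,11) ≥ 36` (certificate `M2K6G18` laddered `1` time(s), grafted `0` time(s)). [folklore] -/
theorem row_2_11 : ¬ PosRootLawAt 2 11 35 := by
  have h := ray 1 0
  norm_num at h
  exact h

/-- `ζ_sym(2,12) ≥ 38` (certificate `M2K6G18` laddered `1` time(s), grafted `1` time(s)). [folklore] -/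
theorem row_2_12 : ¬ PosRootLawAt 2 12 37 := by
  have h := ray 1 1
  norm_num at h
  exact h

/-- `ζ_sym(2,16) ≥ 54` (certificate `M2K6G18` laddered `2` time(s), grafted `0` time(s)). [folklore] -/
theorem row_2_16 : ¬ PosRootLawAt 2 16 53 := by
  have h := ray 2 0
  norm_num at h
  exact h

/-- `ζ_sym(2,21) ≥ 72` (certificate `M2K6G18` laddered `3` time(s), grafted `0` time(s)). [folklore] -/
theorem row_2_21 : ¬ PosRootLawAt 2 21 71 := by
  have h := ray 3 0
  norm_num at h
  exact h

end Summit.ValiantsHypothesis.ValiantsHypothesis.Theorems.LacunarySymmetroidMatrixDescartes.Census.Chain.RayM2K6G18
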